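import Mathlib
import HarnessLib
import HarnessLib.Audit
import Summits.MatrixMultiplication.Statement
import Literature.Computability.AlgebraicComplexity.GroupTheoreticMatMul
import Literature.Computability.AlgebraicComplexity.ChartUSP
import Literature.Computability.AlgebraicComplexity.FlatteningBound
import Literature.Computability.AlgebraicComplexity.GroupTheoreticMatMulProofs
import Literature.Computability.AlgebraicComplexity.AsymptoticRankMultiplesMatMul

/-!
Route: LongBlockAmortisation

CLOSED (superseded) 2026-08-16T21:35:23Z by planner-rchoice-MatrixMultiplication-LongBlock-ed9e3ff7-0 — reason: superseded:route-MatrixMultiplication-EPRFaces — superseded by route-MatrixMultiplication-EPRFaces — note: RETIRED by human ruling (route-choice 2026-08-16 16:2x CDT: retire as superseded; no repair, no new route), following route-review rreview-0816T16-0 (refuter, grade variant, RECOMMEND CLOSE: reduces-to EPRFaces + Coppersmith 1982 / Lotti-Romani 1983). Why: the deciding theorem `closes (h1 : LongBloc. The file is kept as the record of this route; refuted decls are indexed as negative knowledge (`ledger negatives`).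

# Route LongBlockAmortisation — long abelian STPP blocks ⟨n,n,n^k⟩ certify perfect amortisation E
where slice rank is silent; with the face maximiser B, omega = 2

It suffices to show X = LongBlockPackings ∧ B. LONG-BLOCK PACKINGS (new, rank 2): for every η > 0
there are k ≥ 1, a finite abelian
group H and an STPP family (CKSU 2005 Def 5.1 = tree `IsSTPP`) of L blocks all of ONE LONG SHAPE ⟨n,
n, n^k⟩ (|A_i| = |B_i| = n ≥ 2,
|C_i| = n^k) whose long pairing meets the packing bound up to n^η: |H| ≤ L·n^{k+1+η} (always
L·n^{k+1} ≤ |H|). Such a family puts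
L⊙⟨n,n,n^k⟩ inside ℂ[H] (CKSU Thm 5.3, tree `tensorRank_matMulDirectSum_le_card_of_isSTPP`), so by
the rectangular asymptotic sum
inequality (tree `advxxz2025_thm32`) L·n^{ω(1,1,k)} ≤ |H|, i.e. ω(1,1,k) ≤ k+1+η: the packing floor
of a long block IS the cost floor of
perfect amortisation, so LongBlockPackings certifies E = EPRFaces.PerfectAmortisation (∀ ε ∃ k,
R(⟨n,n,n^k⟩) = O(n^{k+1+ε}); this
certificate is PROVED INSIDE the deciding theorem since rev 6, from tree theorems only). B =
EPRFaces.FaceMaximiser verbatim (shared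
item: every admissible β for (1,1,k) has ω + k − 1 ≤ β). E ∧ B ⇒ ω(ℂ) = 2 is EPRFaces' proved
six-line assembly, so the route's deciding
theorem is crux-only: `closes : LongBlockPackings → FaceMaximiser → MatrixMultiplication` (native
audit ok, axioms propext/choice/Quot.sound). Recombination (lens recomb): the OBJECT and ENGINE of
route ThinBlockAlpha
(non-square abelian STPP blocks read as rectangular-exponent certificates; the ℤ/9 null chart +
hashing theorem banked by the refutation
of RectangularThmB), the TARGET FACE and bookkeeping of route EPRFaces (E, B in rank form;
Converse/ModuleGrowthRefutes proved), the
proved size formula of BCCGNSU Thm 3.3 (tree `AddSimultaneousTPP.exists_isBorderTricoloredSumFree`)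
and the translate law of card
stpp-shape-diversity-law; the cruxes (packing form of E, chart engine, bounded-exponent bet, rung
two) are new statements.
Lean: `LongBlockPackings ∧ FaceMaximiser` where `LongBlockPackings := ∀ η : ℝ, 0 < η → ∃ (k : ℕ) (H
: Type) (_ : AddCommGroup H) (_ : Fintype H) (L n : ℕ) (A B C : Fin L → Finset H), 1 ≤ k ∧
Literature.Computability.AlgebraicComplexity.IsSTPP A B C ∧ (∀ i, (A i).card = n ∧ (B i).card = n ∧
(C i).card = n ^ k) ∧ 2 ≤ n ∧ (Fintype.card H : ℝ) ≤ L * (n : ℝ) ^ ((k : ℝ) + 1 + η)`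

## Assembly
`closes (h₁ : LongBlockPackings) (h₂ : FaceMaximiser) : MatrixMultiplication`, proved in the route
file (rev 6). THE CERTIFICATE
(packings ⇒ E), proved inline: from h₁ at η = ε/2 take k ≥ 1, H, L blocks ⟨n,n,n^k⟩ with |H| ≤
L·n^{k+1+η} (L ≥ 1 as |H| ≥ 1); CKSU
Thm 5.3 `tensorRank_matMulDirectSum_le_card_of_isSTPP` gives R(⊕ᵢ⟨n,n,n^k⟩) ≤ |H|; block extraction
`tensorRank_multiple_le_kroneckerPow_matMulDirectSum` (N = 1) + `tensorRank_kroneckerPow_le` give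
R(⟨L⟩⊗⟨n,n,n^k⟩) ≤ |H|; the rectangular
asymptotic sum inequality `advxxz2025_thm32` (q = n, exponents (1,1,k), t = L) +
`asymptoticRank_le_tensorRank_pow_one` give
L·n^{ω(1,1,k)} ≤ R̃ ≤ R ≤ |H| ≤ L·n^{k+1+η}; cancel L, compare exponents at base n ≥ 2: omegaRect ℂ
1 1 k ≤ k+1+η < k+1+ε, so by
`exists_lt_of_csInf_lt` + `mem_rectAdmissibleExponents_of_le` k+1+ε is admissible, and
`rectDim_one`/`rectDim_natCast` turn
R(⟨⌈N^1⌉,⌈N^1⌉,⌈N^k⌉⟩) into R(⟨N,N,N^k⟩) — E in the rank form B consumes. THEN EPRFaces' six lines: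
given ε > 0, E at ε/2 yields k with
R(⟨N,N,N^k⟩) = O(N^{k+1+ε/2}); B gives ω + (k−1) ≤ k+1+ε/2, so ω < 2+ε for every ε, ω ≤ 2; with 2 ≤
ω (`omega_two_le`) ω(ℂ) = 2 =
MatrixMultiplication (`MatrixMultiplication_iff`). The three ranked bets ChartLongPackings /
BoundedLongBlockPackings / RungTwoPackings
reach LongBlockPackings through the one-line proved glues ChartsToPackings, BoundedToLong,
RungTwoToLong (supports); the former
certificate item PackingsCertifyAmortisation is kept as a support (closable by the same proof), no
longer a hypothesis.

Rationale: WHY THIS LINE. BCCGNSU 2017 (arXiv:1605.06702, Thm A/B + Thm 3.3, all proved in the tree) kill ω = 2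
by STPP in abelian groups of bounded exponent
through a border tricolored sum-free set of size Σ_i |A_i||B_i||C_i|/(|A_i|+|B_i|+|C_i|); for long
blocks this is < Σ_i |A_i||B_i| =
L·n² ≤ |H|·n^{1−k}, so for k ≥ 2 the engine only bounds log_n L ≤ ((k+1)(1−δ_ℓ)−2)/δ_ℓ (≈ 9 at ℓ =
2, k = 2, with δ₂ = 1 − h₂(1/3) ≈ 0.082) and NEVER the packing slack
— the same silence ThinBlockAlpha found on the α-face, but here it persists at FIXED exponent (even
𝔽₂^m, 𝔽₃^m), whereas thin packings
need ℓ(a) → ∞ and are proved equivalent to the square packing conjecture X_C (its docstring). Long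
packings are implied by X_C (pad
the long leg with a full cyclic factor; support RungTwoToLong shows the k = 2 rung suffices) and are
not known to imply it (the rotated
product of a (1,1,k)-family certifies only ω ≤ 3(k+1)/(k+2)): they are the WEAKEST abelian-design
statement that still says something,
and what they say is exactly E, the one face of Strassen's spectrum of matrix shapes that no printed
bound implies or contradicts
(EPRFaces review; LeGall2012, arXiv:2404.16349: e(3) ≤ 0.198809, e(5) ≈ 0.16; Huang–Pan
doi:10.1006/jcom.1998.0476 §8). Imported:
additive combinatorics of STPP designs and chart-USPs (arXiv:math/0511460 Def 36/Thm 37, tree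
`CohnKleinbergSzegedyUmans2005_thm37`),
Le Gall's hashing/type-count theorem (arXiv:1401.7714, tree `exists_free_diagonal_jointType_card`),
Strassen's shape-spectrum duality
(tree). New this session and filed as supports: PerfectBlockExclusion (a block with |A||B||C| = |H|
excludes every other block — so
perfect-tiling charts are void: verified exhaustively for the 704 (2,2,4)-factorisation shapes of
ℤ/16, pair hypergraph empty) and
TranslateLaw (third sets that are translates of one W cost Σ|A_i||B_i|·|W| ≤ |H|): the engine must
be LOSSY charts + hashing, and the
banked ℤ/9 null chart re-aimed at composition (1,1,2) is its first computable instance.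

RANKED CRUXES. #2 LongBlockPackings (crux) — for every η > 0: some k ≥ 1, finite abelian H and STPP
family of L blocks ⟨n, n, n^k⟩ (n ≥ 2) with |H| ≤ L·n^{k+1+η} — the packing form of perfect
amortisation E (any exponent allowed; the assembly needs nothing more). [difficulty: open-problem]
(why it might fail: Implied by square packings X_C, not known to be easier: every engine in hand
(lossy charts ≈ CW laser tail) stalls at certified excess e(k) ≥ 0.16–0.36;
EPRFaces.ModuleRankGrowth (R(⟨n,n,N⟩) ≥ n^{1+c}·N) refutes it together with E.) [arXiv:math/0511460,
arXiv:1605.06702, LeGall2012, arXiv:2404.16349, doi:10.1006/jcom.1998.0476]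
#3 FaceMaximiser (crux) — B = EPRFaces.FaceMaximiser VERBATIM (shared item
stmt-MatrixMultiplication-10894): for every k ≥ 1 and every β with R(⟨n,n,n^k⟩) = O(n^β), ω_ℂ + (k −
1) ≤ β (some ω-maximising spectral point lies on the EPR face); inherited unchanged from EPRFaces —
this route adds nothing to B and stakes everything on E. [difficulty: open-problem] (why it might
fail: If ω > 2 every maximiser may be interior (dark points under-counting all three EPR pairs); B
forces ω ≤ 2.198809 (VXXZ2024 k = 3 row), so B is false once ω > 2.1989, and no lossless
square←rectangular transfer is known.) [Strassen1988, VassilevskaWilliamsXuXuZhou2024,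
BurgisserClausenShokrollahi1997, doi:10.1006/jcom.1998.0476]
#4 ChartLongPackings (crux) — THE ENGINE, typed over CKSU Def 36/Thm 37 (tree `IsHChart`,
`IsLocalChartUSP`, `chartBlock`): for every η > 0 some finite abelian H₀, an H₀-chart (Γ, A, B, C)
and an L-row local chart-USP of width m whose product blocks have cards (n, n, n^k), n ≥ 2, k ≥ 1,
with |H₀|^m ≤ L·n^{k+1+η} — long-composition charts reach the packing bound (LOSSY symbols + Le Gall
hashing; perfect symbols are void by PerfectBlockExclusion). [deps: LongBlockPackings] [difficulty:
XL] (why it might fail: A fixed lossy ℤ/ℓ-chart loses rate log(ℓ/|F|) per long coordinate while its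
a/b-entropy h(1/(k+2)) → 0: its e(k)-reading bottoms out near k = 2–3 (ℤ/9 null chart ≈ 0.36) and
worsens beyond (0.39 at k = 4); ℓ, k must grow together and no chart beating the CW_q laser tail is
known.) [arXiv:math/0511460, arXiv:1401.7714, arXiv:1605.06702, arXiv:2307.06463]
#5 BoundedLongBlockPackings (crux) — THE STRUCTURAL BET: one exponent bound ℓ such that for every η
> 0 some abelian group of exponent ≤ ℓ carries a near-tight long-block family (k free) — "the hosts
that provably cannot certify ω = 2 certify E"; its negation would be the first barrier theorem on
the E-face (an E-analogue of Thm B), equally welcome. [deps: LongBlockPackings] [difficulty: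
open-problem] (why it might fail: Chart engines cannot reach it (fixed alphabet ⇒ certificates
worsen as k → ∞); no non-product design near the (B,C)-packing bound is known in (ℤ/ℓ)^m; a two-leg
slice-rank argument on the near-tiling pairs B_i + C_i may prove the E-analogue of Thm B and refute
it.) [arXiv:1605.06702, arXiv:1712.02302, arXiv:math/0511460]
#6 RungTwoPackings (crux) — THE RECORD RUNG k = 2: for every η > 0 an abelian STPP family of L
blocks ⟨n, n, n²⟩ (n ≥ 2) with |H| ≤ L·n^{3+η}; it certifies ω(1,1,2) = 3 (=
EPRFaces.RectExponentTwoEqThree, hence E at k = 2 and ω ≤ 9/4 by 4ω ≤ 3ω(1,1,2)); implied by X_C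
(pad ⟨n,n,n⟩ by ({0},{0},ℤ/n)); the dial: slack |H| ≤ L·n^{3+s} with s < 0.250035 beats the
rectangular record, s < 0.1618 beats ω < 2.371339. [deps: LongBlockPackings] [difficulty:
open-problem] (why it might fail: It forces ω(1,1,2) = 3 (record 3.250035, ADVXXZ2025) and ω ≤ 2.25
— a world record by an abelian design, while no abelian STPP family of any shape beating CKSU's
2.41-type charts is known; the ℤ/9 null chart at composition (1,1,2) reads only ≈ 3.36.)
[arXiv:2404.16349, LeGall2012, arXiv:math/0511460, arXiv:1605.06702]
#9 PerfectAmortisation (support) — E = EPRFaces.PerfectAmortisation VERBATIM (shared item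
stmt-MatrixMultiplication-10893), the waypoint the packings certify: ∀ ε > 0 ∃ k ≥ 1, R(⟨n,n,n^k⟩) =
O(n^{k+1+ε}). [difficulty: open-problem] [LeGall2012, LottiRomani1983, doi:10.1006/jcom.1998.0476]
#9 PackingsCertifyAmortisation (support; was a rank-7 crux until rev 7) — THE CERTIFICATE
LongBlockPackings → E (E inlined in
rank form), PROVED INSIDE `closes` since rev 6 and therefore no longer a hypothesis of the deciding
theorem; closable as a
stand-alone support by the same proof: STPP ⇒ R(⊕ᵢ⟨n,n,n^k⟩) ≤ |H|
(`tensorRank_matMulDirectSum_le_card_of_isSTPP`), block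
extraction R(⟨L⟩⊗⟨n,n,n^k⟩) ≤ R(⊕ᵢ) (`tensorRank_multiple_le_kroneckerPow_matMulDirectSum`, N = 1),
L·n^{ω(1,1,k)} ≤ R̃(⟨L⟩⊗⟨n,n,n^k⟩) ≤ R
(`advxxz2025_thm32`, `asymptoticRank_le_tensorRank_pow_one`), cancel L and compare exponents, then
`exists_lt_of_csInf_lt` + upward
closure + `rectDim_natCast`. [difficulty: provable-now] [arXiv:math/0511460, arXiv:2404.16349,
Blaser2013]
#9 ChartsToPackings (support) — glue, provable now: ChartLongPackings → LongBlockPackings — CKSU Thm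
37 (tree `CohnKleinbergSzegedyUmans2005_thm37`) makes the product blocks an IsSTPP family in Fin m →
H₀, whose Fintype.card is |H₀|^m; reindex Fin m → H₀ as the host H. [difficulty: provable-now]
[arXiv:math/0511460]
#9 BoundedToLong (support) — glue, provable now (proved in Sketch.lean): forget the exponent bound.
[difficulty: provable-now] [arXiv:math/0511460]
#9 RungTwoToLong (support) — glue, provable now (proved in Sketch.lean): k := 2, ((2:ℕ):ℝ)+1+η =
3+η. [difficulty: provable-now] [arXiv:math/0511460]
#9 TranslateLaw (support) — DESIGN RULE 1 (new, provable now; sharpens card stpp-shape-diversity-law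
for long blocks): in any abelian STPP family whose third sets are translates of ONE set W (C_i = W +
c_i), the map (i, s′, t, w) ↦ s′ − t + w is injective (STPP at the index pattern (i, i′, i′) with u,
u′ ∈ W + c_{i′}), so Σ_i |A_i||B_i|·|W| ≤ |H|: coset / common-translate designs pay |H| ≥ L·n^{k+2},
efficiency ≤ 1/n — the long sets must be pairwise translation-inequivalent. [difficulty:
provable-now] [arXiv:math/0307321, arXiv:1605.06702]
#9 PerfectBlockExclusion (support) — DESIGN RULE 2 (new, provable now): if one block of an abelian
STPP family with non-empty sets tiles the host, |A_{i₀}||B_{i₀}||C_{i₀}| = |H| (so A_{i₀} + B_{i₀} −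
C_{i₀} = H by TPP-injectivity), then it is the ONLY block: for k ≠ i₀ any s + t − u′ (s ∈ A_k, t ∈
B_{i₀}, u′ ∈ C_k) equals some a + b − c, an STPP relation at pattern (i₀, i₀, k). Consequence: chart
symbols that are factorisations H₀ = A ⊕ B ⊕ C have EMPTY pair hypergraph (checked exhaustively:
ℤ/16, type (2,2,4), 704 shapes, 0 witnessable pairs) — every usable chart is lossy. [difficulty:
provable-now] [arXiv:math/0307321, arXiv:math/0511460]

TWO-LAYER PLAN. Foreseen glued splits (none filed now): LongBlockPackings ⇐ ChartLongPackings
(engine; glue ChartsToPackings filed) or ⇐ a non-product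
(Fourier/automatic) design line; ChartLongPackings ⇐ LongChartEntropyBudget (for every δ > 0 a lossy
ℤ/ℓ-chart and long composition with
min-marginal entropy minus Le Gall penalty ≥ log₂ℓ − ((k+1)/(k+2))·log₂|F| − δ — pure entropy
arithmetic over the chart's profile
structure) → HashingToUSP (tree `exists_free_diagonal_jointType_card` + the chart's Farkas/trapping
analysis, as in
Theorems/ThinBlockAlphaRectangularThmBRefutation) → ChartLongPackings; RungTwoPackings ⇐ a
finite-alphabet chart whose (1,1,2)-reading
beats 3 + 0.1618 (record dial) before 3 + η; FaceMaximiser ⇐ its k = 2 instance ω(1,1,2) = ω + 1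
(convexity, proved in tree) — EPRFaces' business.

KILL CRITERIA. (1) EPRFaces.ModuleRankGrowth PROVED (R(⟨n,n,N⟩) ≥ n^{1+c}·N) refutes
PerfectAmortisation, hence LongBlockPackings, every packing crux
and the summit at once (ModuleGrowthRefutes, proved): close `refuted:LongBlockPackings`, hand the
witness to route BorderRankLowerBound.
(2) An E-ANALOGUE OF THM B — ∀ ℓ ∃ c_ℓ > 0: every exponent-≤ℓ long-block family has |H| ≥
L·n^{k+1+c_ℓ} — refutes BoundedLongBlockPackings
only: drop it (`--drop`, the assembly does not need it), file the theorem as a Literature/Barriers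
entry (first barrier on the E-face) and
keep LongBlockPackings in unbounded exponent. (3) FaceMaximiser refuted (an interior dark maximiser,
or ω certified > 2.198809 some day)
breaks this route AND EPRFaces: pivot the packing half to ShapeSubmodularity's assembly (SUBMOD ∧ E)
by `route edit --closes-file`.
(4) PerfectAmortisation proved elsewhere (laser tail, face universality) moots the packing cruxes as
a ROUTE to ω (B remains) but not as
statements; X_C (GroupTheoreticSTPP.CPackingConstruction) proved moots everything.

NOT DECOMPOSED YET. The entropy budget of specific lossy charts at long compositions (which ℤ/ℓ,
which symbol set, which composition minimises the
certified e(k); the ℤ/9 null chart's ≈0.36 at (1,1,2) is an uncertified first reading), the penalty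
term Γ_S of Le Gall's hashing for
those profiles, and any non-product design (Fourier / automatic / value-separated) are layer-2
children of ChartLongPackings and
LongBlockPackings; the quantitative form of the slice-rank window (log_n L ≤ ((k+1)(1−δ_ℓ)−2)/δ_ℓ)
is a remark, not an item; B is not
decomposed here at all (EPRFaces owns it).

CHEAPEST FALSIFIER. Run first: (a) the TWO-LEG SLICE-RANK TEST on BoundedLongBlockPackings — take
the near-tiling pairs (B_i, C_i) of a long family in
(ℤ/ℓ)^m and try to extract a tricolored-sum-free-type object of size ≈ Σ|B_i||C_i| rather than Σ
vol/perimeter (I could not: every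
blockwise induced matching is capped by min pairwise product = n², computed); success = kill (2).
(b) the ENTROPY ARITHMETIC of the banked
ℤ/9 null chart at compositions (1,1,k): if its Le Gall penalty is 0 as at (7,2,7,2), it certifies
e(2) ≲ 0.36, e(3) ≈ 0.36, e(4) ≈ 0.39
(worse than laser's 0.25/0.20) — confirming that ChartLongPackings needs NEW charts, not re-aimed
old ones; a proof that EVERY ℤ/ℓ-chart's
long reading is bounded below by c > 0 uniformly in ℓ would kill ChartLongPackings. Already run this
session (compute/charts16*.py,
local, < 2 min): perfect (2,2,4)-charts of ℤ/16 — 180224 symbols, 704 shapes, 3-wise hypergraph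
density 1.4 %, pair hypergraph EMPTY
(exhaustive) ⇒ capacity 0, which is why PerfectBlockExclusion is filed and the engine is stated for
lossy charts.

NUMBERS. ω < 2.371339 (ADVXXZ2025 = arXiv:2404.16349); ω(1,1,2) = ω(1,2,1) ≤ 3.250035 (ibid. Table
1); e(k) := ω(1,1,k) − k − 1: e(3) ≤ 0.198809
(VXXZ2024 = arXiv:2307.07970, k = 3 row), ≈ 0.16 at k = 5 (LeGall2012); B ⇒ ω ≤ 2.198809;
RungTwoPackings ⇒ ω(1,1,2) = 3 ⇒ ω ≤ 9/4;
slack s in |H| ≤ L·n^{3+s}: s < 0.250035 beats the rectangular record, s < 0.1618 beats 2.371339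
(via 4ω ≤ 3ω(1,1,2)); abelian charts:
CKSU 2.48 / 2.41 (arXiv:math/0511460), ThinBlockAlpha's ℤ/9 null chart certifies ω(1,2/7,1) = 2
(tree, not_RectangularThmB) and reads
≈ 2.41 at (1,1,1), ≈ 3.36 at (1,1,2) (uncertified); slice-rank window for long families: log_n L ≤
((k+1)(1−δ_ℓ)−2)/δ_ℓ (void for k = 1,
≈ 9 at ℓ = 2, k = 2). Items at open: 13 (5 cruxes incl. the shared B, 7 supports, 1 assembly).

DEFINITION REQUESTS. None: IsSTPP, IsHChart, IsLocalChartUSP, chartBlock, tensorRank, matMulTensor,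
omega, AddMonoid.exponent all exist (lean search --decl
checked; Sketch.lean elaborates rc 0 with `closes`, BoundedToLong and RungTwoToLong proved).

Novelty: Searches (2026-08-16; local searchd DOWN — `lit search` ×4 ConnectionReset, `--hybrid` unavailable;
OpenAlex daily budget exhausted; S2 HTTP
429; arXiv API 0 rows): `lit search --source zbmath "group-theoretic matrix multiplication
rectangular"` (2, irrelevant), `"triple product
property rectangular"` (1, irrelevant), `"uniquely solvable puzzle"` (7: Anderson–Ji–Xu
arXiv:2301.00074, Anderson–Le arXiv:2307.06463 —
SUSP verification/search, square only), `"triple product property"` (15: Neumann 2011, Hedtke–Murthy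
2012 — TPP search, square);
`lit search --source crossref "group-theoretic rectangular matrix multiplication"` (15:
CohnUmans2003, CKSU2005, BCCGNSU2017, Coppersmith1997,
HuangPan1998, LeGall2012 — no paper joins group-theoretic designs to rectangular exponents),
`"triple product property rectangular"` (9:
Hedtke 2015 upgrading subgroup TPP triples); `lit galaxy search "simultaneous triple product
property" --star pdf` (4: CKSU05, Stothers
thesis ×2, Sawin arXiv:1702.00905), `"rectangular matrix multiplication" --star all` (60 rows,
algorithms/applications only); `lit vsearch`
"STPP constructions yielding bounds on ω(1,1,k) or α" (12 docs: BCS1997 pp 361/721, Landsberg2017 pp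
82–84 — general STPP/laser text);
`lit read arxiv:math/0511460 --grep rectangular|amortiz|matrix-vector` (0 hits; Def 36/Thm 37 p0011
read), `lit read
doi:10.1006/jcom.1998.0476` §8.1–8.3 (Huang–Pan: ω(t,1,r) ≤ r+1+ε only for t ≤ 0.294; no large-r
amortisation); hub: all 63 route
files + 46 open  [refs: 10.1006/jcom.1998.0476`, 2301.00074, 2307.06463, 1702.00905, math/0511460, 1605.06702, arxiv:math/0511460, doi:10.1006/jcom.1998.0476, CohnUmans2003, Coppersmith1997, LeGall2012, Landsberg2017]

Barriers (technique_class: abelian-STPP, long-blocks, amortisation-face, chart-USP): - technique_class: abelian-STPP, long-blocks, amortisation-face, chart-USP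
- Literature.Barriers.MatrixMultiplication.TricoloredSumFreeBarrier: evaded quantitatively, not
rhetorically — its engine (tree Thm 3.3 + Lemma 3.4 + Thm A) sees a long family only through a
border tricolored sum-free set of size < Σ|A_i||B_i| = L·n² ≤ |H|·n^{1−k}, so for k ≥ 2 it bounds
log_n L ≤ ((k+1)(1−δ_ℓ)−2)/δ_ℓ and never the packing slack η; the square case k = 1 of the same
formula is the barrier itself. Caveat = Kill (2): a two-leg version on the near-tiling pairs would
re-impose it on BoundedLongBlockPackings.
- Literature.Barriers.MatrixMultiplication.RectangularBarrier: constrains T-methods (powers of ONE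
intermediate tensor) for ω(p) at fixed p and for α; a family of STPP designs is not a T-method, and
the face value k → ∞ of the CW_q barrier is not tabulated (CLLZ Table 1 is fixed-p) — the
upper-support functional with θ on the edge θ₁ = 0 reads exactly p+1, and as p → ∞ the bound from
every upper support functional tends to p+1 (the excess is ≤ [2t·log(q+2) − (p+1)g(t)]₊ → 0), i.e.
the catalogued barrier is silent on E in the limit; charts that merely simulate CW_q powers inherit
whatever the laser tail inherits (conceded).
- Literature.Barriers.MatrixMultiplication.BoundedRankFrameBarrier: concerns frames/lines in 𝔽_q^m
of bounded RANK m with q → ∞ (square reading); our hosts are (ℤ/ℓ)^m with m → ∞ or arbitrary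
abelian; not in play, and ConeDesigns-type line families are avoided.
- Lite

Novelty grade: variant — route-review rreview-0816T16-0 (refuter) OBJECTION / RECOMMEND CLOSE (reduces-to: EPRFaces + Coppersmith1982/LottiRomani1983): the deciding theorem closes (h₁ : LongBlockPackings) (h₂ : FaceMaximiser) uses h₁ ONLY to derive E = PerfectAmortisation (∀ε ∃k, R(<n,n,n^k>) = O(n^{k+1+ε})), and E is a THE (refuter refuter-rreview-0816T16-0-0, 2026-08-16T16:43:20Z; prior: doi:10.1137/0211037 (Coppersmith 1982, p.471: ∀β>0 ∃α>1 Rank(<N,N,N^α>)=O(N^{α+1+β}(log N)^{3/2})), doi:10.1016/0304-3975(83)90054-3 (Lotti–Romani 1983, Prop 4.1: inf_x[ω(1,1,x)−x]=1), doi:10.1137/0210032 (Schönhage 1981, partial matrix multiplication, bR(<k,n,1>⊕<1,1,(k−1)(n−1)>)=kn+1), route-MatrixMultiplication-EPRFaces (lever B = FaceMaximiser, shared item stmt-MatrixMultiplication-10894))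

History (route lifecycle, newest last):
- 2026-08-16T16:15:58Z · rev 3: restated Assembly (stmt-MatrixMultiplication-15896) — align Assembly with the crux-only closes (rev 1/2) (planner-plan-lens-MatrixMultiplication-recomb-v2-0)
- 2026-08-16T16:16:38Z · rev 4: dropped LongBlocksCertifyE — drop redundant support LongBlocksCertifyE (= PackingsCertifyAmortisation with the conclusion named PerfectAmortisation; superseded by the rank-7 crux used by cl (planner-plan-lens-MatrixMultiplication-recomb-v2-0)
- 2026-08-16T16:32:20Z · rev 8: restated Assembly (stmt-MatrixMultiplication-16069) — align the optional Assembly item with the crux-only closes of rev 6 (PackingsCertifyAmortisation is no longer a hypothesis; it is proved inline) (planner-rbadge-MatrixMultiplication-LongBlockA-62a3cad0-0)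
- 2026-08-16T21:35:23Z · CLOSED superseded — superseded:route-MatrixMultiplication-EPRFaces (planner-rchoice-MatrixMultiplication-LongBlock-ed9e3ff7-0)

sub-problem: MatrixMultiplication · status: closed(superseded) · opened planner-plan-lens-MatrixMultiplication-recomb-v2-0 2026-08-16T16:03:21Z · rev 9 · ledger route-MatrixMultiplication-LongBlockAmortisation
GENERATED by the gate from the ledger (D-0016/17). Provers cite these decls: `theorem foo : Summit.MatrixMultiplication.MatrixMultiplication.Theses.LongBlockAmortisation.<Decl> := …` in Summits/MatrixMultiplication/MatrixMultiplication/Theorems/<Name>.lean.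
-/

namespace Summit.MatrixMultiplication.MatrixMultiplication.Theses.LongBlockAmortisation

open scoped BigOperators Topology Manifold Classical MeasureTheory ProbabilityTheory Matrix InnerProductSpace ComplexConjugate ContinuousMap
open Filter Set Function TopologicalSpace MeasureTheory

attribute [summit_statement] _root_.MatrixMultiplication

/-- item stmt-MatrixMultiplication-15886 · crux · rank 2 · closed · moot by None · by planner
why it might fail: Implied by square packings X_C, not known to be easier: every engine in hand (lossy charts ≈ CW laser tail) stalls at certified excess e(k) ≥ 0.16–0.36; EPRFaces.ModuleRankGrowth (R(⟨n,n,N⟩) ≥ n^{1+c}·N) refutes it together with E.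
sources: arXiv:math/0511460, arXiv:1605.06702, LeGall2012, arXiv:2404.16349, doi:10.1006/jcom.1998.0476
[crux] for every η > 0: some k ≥ 1, finite abelian H and STPP family of L blocks ⟨n, n, n^k⟩ (n ≥ 2)
with |H| ≤ L·n^{k+1+η} — the packing form of perfect amortisation E (any exponent allowed; the
assembly needs nothing more). [difficulty: open-problem] -/
@[route_item "route-MatrixMultiplication-LongBlockAmortisation"]
def LongBlockPackings : Prop :=
  ∀ η : ℝ, 0 < η → ∃ (k : ℕ) (H : Type) (_ : AddCommGroup H) (_ : Fintype H) (L n : ℕ) (A B C : Fin L → Finset H), 1 ≤ k ∧ Literature.Computability.AlgebraicComplexity.IsSTPP A B C ∧ (∀ i, (A i).card = n ∧ (B i).card = n ∧ (C i).card = n ^ k) ∧ 2 ≤ n ∧ (Fintype.card H : ℝ) ≤ L * (n : ℝ) ^ ((k : ℝ) + 1 + η)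

/-- item stmt-MatrixMultiplication-10894 · crux · rank 3 · open · by planner
why it might fail: If ω > 2 every maximiser may be interior (dark points under-counting all three EPR pairs); B forces ω ≤ 2.198809 (VXXZ2024 k = 3 row), so B is false once ω > 2.1989, and no lossless square←rectangular transfer is known.
sources: Strassen1988, VassilevskaWilliamsXuXuZhou2024, BurgisserClausenShokrollahi1997, doi:10.1006/jcom.1998.0476
[crux] B in RANK FORM: for every natural k ≥ 1 and every real β with R(⟨n,n,n^k⟩) = O(n^β) (R =
tensorRank of matMulTensor ℂ n n (n^k)), ω_ℂ + (k − 1) ≤ β; equivalent to ω + (k − 1) ≤ ω(1,1,k)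
(le_csInf / csInf_le: rectAdmissibleExponents nonempty and bounded below, both in tree; the reverse
inequality is blocking, omegaRect_one_one_le_add): ⟨n,n,n^k⟩ has no asymptotic economy over n^{k−1}
square products, d = 0. Chart form (support SpectralFaceForm): some universal spectral point F with
F(⟨2,2,2⟩) = 2^ω (a maximiser) has F(⟨1,1,2⟩) = 2, i.e. lies on the EPR face l₃ = 1. By convexity
(omegaRect_convexOn_middle_holds, proved) the single value k = 2, ω(1,1,2) = ω + 1, already gives
all k. [difficulty: open-problem] -/
@[route_item "route-MatrixMultiplication-LongBlockAmortisation"]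
def FaceMaximiser : Prop :=
  ∀ k : ℕ, 1 ≤ k → ∀ β : ℝ, ((fun n : ℕ => (Literature.Computability.AlgebraicComplexity.tensorRank (Literature.Computability.AlgebraicComplexity.matMulTensor ℂ n n (n ^ k)) : ℝ)) =O[Filter.atTop] fun n : ℕ => (n : ℝ) ^ β) → Literature.Computability.AlgebraicComplexity.omega ℂ + ((k : ℝ) - 1) ≤ β

/-- item stmt-MatrixMultiplication-15887 · crux · rank 4 · closed · moot by None · by planner
why it might fail: A fixed lossy ℤ/ℓ-chart loses rate log(ℓ/|F|) per long coordinate while its a/b-entropy h(1/(k+2)) → 0: its e(k)-reading bottoms out near k = 2–3 (ℤ/9 null chart ≈ 0.36) and worsens beyond (0.39 at k = 4); ℓ, k must grow together and no chart beating the CW_q laser tail is known.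
sources: arXiv:math/0511460, arXiv:1401.7714, arXiv:1605.06702, arXiv:2307.06463
[crux] THE ENGINE, typed over CKSU Def 36/Thm 37 (tree `IsHChart`, `IsLocalChartUSP`, `chartBlock`):
for every η > 0 some finite abelian H₀, an H₀-chart (Γ, A, B, C) and an L-row local chart-USP of
width m whose product blocks have cards (n, n, n^k), n ≥ 2, k ≥ 1, with |H₀|^m ≤ L·n^{k+1+η} —
long-composition charts reach the packing bound (LOSSY symbols + Le Gall hashing; perfect symbols
are void by PerfectBlockExclusion). [deps: LongBlockPackings] [difficulty: XL] -/
@[route_item "route-MatrixMultiplication-LongBlockAmortisation"]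
def ChartLongPackings : Prop :=
  ∀ η : ℝ, 0 < η → ∃ (k : ℕ) (H₀ : Type) (_ : AddCommGroup H₀) (_ : Fintype H₀) (_ : DecidableEq H₀) (Γ : Type) (A B C : Γ → Finset H₀) (m L n : ℕ) (row : Fin L → Fin m → Γ), 1 ≤ k ∧ Literature.Computability.AlgebraicComplexity.IsHChart A B C ∧ Literature.Computability.AlgebraicComplexity.IsLocalChartUSP A B C row ∧ (∀ i, (Literature.Computability.AlgebraicComplexity.chartBlock A row i).card = n ∧ (Literature.Computability.AlgebraicComplexity.chartBlock B row i).card = n ∧ (Literature.Computability.AlgebraicComplexity.chartBlock C row i).card = n ^ k) ∧ 2 ≤ n ∧ (Fintype.card H₀ : ℝ) ^ m ≤ L * (n : ℝ) ^ ((k : ℝ) + 1 + η)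

/-- item stmt-MatrixMultiplication-15888 · crux · rank 5 · closed · moot by None · by planner
why it might fail: Chart engines cannot reach it (fixed alphabet ⇒ certificates worsen as k → ∞); no non-product design near the (B,C)-packing bound is known in (ℤ/ℓ)^m; a two-leg slice-rank argument on the near-tiling pairs B_i + C_i may prove the E-analogue of Thm B and refute it.
sources: arXiv:1605.06702, arXiv:1712.02302, arXiv:math/0511460
[crux] THE STRUCTURAL BET: one exponent bound ℓ such that for every η > 0 some abelian group of
exponent ≤ ℓ carries a near-tight long-block family (k free) — "the hosts that provably cannot
certify ω = 2 certify E"; its negation would be the first barrier theorem on the E-face (an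
E-analogue of Thm B), equally welcome. [deps: LongBlockPackings] [difficulty: open-problem] -/
@[route_item "route-MatrixMultiplication-LongBlockAmortisation"]
def BoundedLongBlockPackings : Prop :=
  ∃ ℓ : ℕ, ∀ η : ℝ, 0 < η → ∃ (k : ℕ) (H : Type) (_ : AddCommGroup H) (_ : Fintype H) (L n : ℕ) (A B C : Fin L → Finset H), AddMonoid.exponent H ≤ ℓ ∧ 1 ≤ k ∧ Literature.Computability.AlgebraicComplexity.IsSTPP A B C ∧ (∀ i, (A i).card = n ∧ (B i).card = n ∧ (C i).card = n ^ k) ∧ 2 ≤ n ∧ (Fintype.card H : ℝ) ≤ L * (n : ℝ) ^ ((k : ℝ) + 1 + η)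

/-- item stmt-MatrixMultiplication-15889 · crux · rank 6 · closed · moot by None · by planner
why it might fail: It forces ω(1,1,2) = 3 (record 3.250035, ADVXXZ2025) and ω ≤ 2.25 — a world record by an abelian design, while no abelian STPP family of any shape beating CKSU's 2.41-type charts is known; the ℤ/9 null chart at composition (1,1,2) reads only ≈ 3.36.
sources: arXiv:2404.16349, LeGall2012, arXiv:math/0511460, arXiv:1605.06702
[crux] THE RECORD RUNG k = 2: for every η > 0 an abelian STPP family of L blocks ⟨n, n, n²⟩ (n ≥ 2)
with |H| ≤ L·n^{3+η}; it certifies ω(1,1,2) = 3 (= EPRFaces.RectExponentTwoEqThree, hence E at k = 2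
and ω ≤ 9/4 by 4ω ≤ 3ω(1,1,2)); implied by X_C (pad ⟨n,n,n⟩ by ({0},{0},ℤ/n)); the dial: slack |H| ≤
L·n^{3+s} with s < 0.250035 beats the rectangular record, s < 0.1618 beats ω < 2.371339. [deps:
LongBlockPackings] [difficulty: open-problem] -/
@[route_item "route-MatrixMultiplication-LongBlockAmortisation"]
def RungTwoPackings : Prop :=
  ∀ η : ℝ, 0 < η → ∃ (H : Type) (_ : AddCommGroup H) (_ : Fintype H) (L n : ℕ) (A B C : Fin L → Finset H), Literature.Computability.AlgebraicComplexity.IsSTPP A B C ∧ (∀ i, (A i).card = n ∧ (B i).card = n ∧ (C i).card = n ^ 2) ∧ 2 ≤ n ∧ (Fintype.card H : ℝ) ≤ L * (n : ℝ) ^ ((3 : ℝ) + η)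

/-- item stmt-MatrixMultiplication-15964 · support · rank 7 · closed · moot by None · by planner
why it might fail: Provable now modulo typing (CKSU 5.3 + rectangular ASI + omegaRect/rank-form dictionary, all in tree): the only risk is a convention mismatch (⌈m^k⌉ dims, =O normalisation) — a failed proof would mean LongBlockPackings is mis-typed, not that the mathematics fails.
sources: arXiv:math/0511460, arXiv:2404.16349, Blaser2013, LeGall2012
[crux] THE CERTIFICATE in hypothesis form for the deciding theorem (gate rule: hypotheses of closes
are cruxes): long-block packings certify perfect amortisation E — the conclusion is
EPRFaces.PerfectAmortisation VERBATIM (rank form), inlined. Proof (provable now, M): STPP ⇒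
R(L⊙⟨n,n,n^k⟩) ≤ |H| (tree tensorRank_matMulDirectSum_le_card_of_isSTPP) ≤ L·n^{k+1+η};
L·R~(⟨n,n,n^k⟩) ≤ R~(⟨L⟩⊗⟨n,n,n^k⟩) ≤ R (tree mul_asymptoticRank_matMulTensor_le +
tensorRestrictsTo_unit_kronecker_matMulDirectSum-type reindexing); R~(⟨n,n,n^k⟩) = n^{ω(1,1,k)}
(tree asymptoticRank_matMulTensor_rect, q := n); so omegaRect ℂ 1 1 k ≤ k+1+η < k+1+ε for η := ε/2,
and the dictionary eprFaces_isBigO_iff_mem_rectAdmissibleExponents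
(Theorems/EPRFacesSpectralFaceForm) + exists_lt_of_csInf_lt + upward closure
(mem_rectAdmissibleExponents_of_le) give the =O form. Supersedes support LongBlocksCertifyE (same
content, conclusion named). why it might fail: only a typing/convention mismatch (⌈m^k⌉ dims, =O
normalisation) — a failed proof would mean LongBlockPackings is mis-typed, not that the mathematics
fails. sources: arXiv:math/0511460, arXiv:2404.16349, Blaser2013, LeGall2012 [deps:
LongBlockPackings] [difficulty: M] -/
@[route_item "route-MatrixMultiplication-LongBlockAmortisation"]
def PackingsCertifyAmortisation : Prop :=
  LongBlockPackings → ∀ ε : ℝ, 0 < ε → ∃ k : ℕ, 1 ≤ k ∧ (fun n : ℕ => (Literature.Computability.AlgebraicComplexity.tensorRank (Literature.Computability.AlgebraicComplexity.matMulTensor ℂ n n (n ^ k)) : ℝ)) =O[Filter.atTop] fun n : ℕ => (n : ℝ) ^ ((k : ℝ) + 1 + ε)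

/-- item stmt-MatrixMultiplication-10893 · support · rank 9 · open · by planner
sources: LeGall2012, LottiRomani1983, doi:10.1006/jcom.1998.0476
[crux] E, the card's face statement in form (i): e(∞) = lim_k [ω(1,1,k) − k − 1] = 0, filed in RANK
FORM as ∀ ε > 0 ∃ k ≥ 1, R(⟨n,n,n^k⟩) = O(n^{k+1+ε}) with R(⟨n,n,n^k⟩) = tensorRank (matMulTensor ℂ
n n (n^k)); equivalent to ∀ ε ∃ k, ω(1,1,k) ≤ k + 1 + ε (ω(1,1,k) = omegaRect ℂ 1 1 k is the inf of
exactly these β since ⌈n^k⌉ = n^k; the ε-slack is absorbed by the quantifiers; e(k) ≥ 0 and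
nonincreasing by add_one_le_omegaRect_one_mid_one, omegaRect_one_mid_one, omegaRect_one_one_le_add,
so lim = inf = 0). Equivalent forms: the module rank / border rank per vector ρ(n), β(n) are
n^{1+o(1)} (log_n β(n) ≥ 1 + e(∞) for every n by a tensor-power argument); no universal spectral
point on a side face of Strassen's chart beyond the base edge (h = 1). [difficulty: open-problem] -/
@[route_item "route-MatrixMultiplication-LongBlockAmortisation"]
def PerfectAmortisation : Prop :=
  ∀ ε : ℝ, 0 < ε → ∃ k : ℕ, 1 ≤ k ∧ (fun n : ℕ => (Literature.Computability.AlgebraicComplexity.tensorRank (Literature.Computability.AlgebraicComplexity.matMulTensor ℂ n n (n ^ k)) : ℝ)) =O[Filter.atTop] fun n : ℕ => (n : ℝ) ^ ((k : ℝ) + 1 + ε)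

/-- item stmt-MatrixMultiplication-15891 · support · rank 9 · closed · moot by None · by planner
sources: arXiv:math/0511460
[support] glue, provable now: ChartLongPackings → LongBlockPackings — CKSU Thm 37 (tree
`CohnKleinbergSzegedyUmans2005_thm37`) makes the product blocks an IsSTPP family in Fin m → H₀,
whose Fintype.card is |H₀|^m; reindex Fin m → H₀ as the host H. [difficulty: provable-now] -/
@[route_item "route-MatrixMultiplication-LongBlockAmortisation"]
def ChartsToPackings : Prop :=
  ChartLongPackings → LongBlockPackings

/-- item stmt-MatrixMultiplication-15892 · support · rank 9 · closed · moot by None · by planner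
sources: arXiv:math/0511460
[support] glue, provable now (proved in Sketch.lean): forget the exponent bound. [difficulty:
provable-now] -/
@[route_item "route-MatrixMultiplication-LongBlockAmortisation"]
def BoundedToLong : Prop :=
  BoundedLongBlockPackings → LongBlockPackings

/-- item stmt-MatrixMultiplication-15893 · support · rank 9 · closed · moot by None · by planner
sources: arXiv:math/0511460
[support] glue, provable now (proved in Sketch.lean): k := 2, ((2:ℕ):ℝ)+1+η = 3+η. [difficulty:
provable-now] -/
@[route_item "route-MatrixMultiplication-LongBlockAmortisation"]
def RungTwoToLong : Prop :=
  RungTwoPackings → LongBlockPackings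

/-- item stmt-MatrixMultiplication-15894 · support · rank 9 · closed · moot by None · by planner
sources: arXiv:math/0307321, arXiv:1605.06702
[support] DESIGN RULE 1 (new, provable now; sharpens card stpp-shape-diversity-law for long blocks):
in any abelian STPP family whose third sets are translates of ONE set W (C_i = W + c_i), the map (i,
s′, t, w) ↦ s′ − t + w is injective (STPP at the index pattern (i, i′, i′) with u, u′ ∈ W + c_{i′}),
so Σ_i |A_i||B_i|·|W| ≤ |H|: coset / common-translate designs pay |H| ≥ L·n^{k+2}, efficiency ≤ 1/n
— the long sets must be pairwise translation-inequivalent. [difficulty: provable-now] -/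
@[route_item "route-MatrixMultiplication-LongBlockAmortisation"]
def TranslateLaw : Prop :=
  ∀ (H : Type) [AddCommGroup H] [Fintype H] (L : ℕ) (A B C : Fin L → Finset H) (W : Finset H) (c : Fin L → H), Literature.Computability.AlgebraicComplexity.IsSTPP A B C → (∀ i x, x ∈ C i ↔ x - c i ∈ W) → (∑ i, (A i).card * (B i).card) * W.card ≤ Fintype.card H

/-- item stmt-MatrixMultiplication-15895 · support · rank 9 · closed · moot by None · by planner
sources: arXiv:math/0307321, arXiv:math/0511460
[support] DESIGN RULE 2 (new, provable now): if one block of an abelian STPP family with non-empty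
sets tiles the host, |A_{i₀}||B_{i₀}||C_{i₀}| = |H| (so A_{i₀} + B_{i₀} − C_{i₀} = H by
TPP-injectivity), then it is the ONLY block: for k ≠ i₀ any s + t − u′ (s ∈ A_k, t ∈ B_{i₀}, u′ ∈
C_k) equals some a + b − c, an STPP relation at pattern (i₀, i₀, k). Consequence: chart symbols that
are factorisations H₀ = A ⊕ B ⊕ C have EMPTY pair hypergraph (checked exhaustively: ℤ/16, type
(2,2,4), 704 shapes, 0 witnessable pairs) — every usable chart is lossy. [difficulty: provable-now] -/
@[route_item "route-MatrixMultiplication-LongBlockAmortisation"]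
def PerfectBlockExclusion : Prop :=
  ∀ (H : Type) [AddCommGroup H] [Fintype H] (L : ℕ) (A B C : Fin L → Finset H), Literature.Computability.AlgebraicComplexity.IsSTPP A B C → (∀ i, (A i).Nonempty ∧ (B i).Nonempty ∧ (C i).Nonempty) → ∀ i₀ : Fin L, (A i₀).card * (B i₀).card * (C i₀).card = Fintype.card H → ∀ i : Fin L, i = i₀

-- earlier Assembly (stmt-MatrixMultiplication-15896, replaced 2026-08-16T16:15:58Z -> stmt-MatrixMultiplication-16069): retired by None — LongBlockPackings → LongBlocksCertifyE → FaceMaximiser → _root_.MatrixMultiplication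
-- earlier Assembly (stmt-MatrixMultiplication-16069, replaced 2026-08-16T16:32:20Z -> stmt-MatrixMultiplication-16321): retired by None — LongBlockPackings → PackingsCertifyAmortisation → FaceMaximiser → _root_.MatrixMultiplication
/-- item stmt-MatrixMultiplication-16321 · assembly · rank 1 · closed · moot by None · by planner
sources: Strassen1988, arXiv:math/0511460, LeGall2012
[assembly] LongBlockPackings → FaceMaximiser → MatrixMultiplication — exactly the deciding theorem
`closes` (rev 6): the certificate LongBlockPackings ⇒ perfect amortisation E is proved INSIDE closes
(CKSU Thm 5.3 reduction + block extraction + rectangular asymptotic sum inequality advxxz2025_thm32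
+ R̃ ≤ R + the omegaRect/admissible-exponent dictionary), and the face maximiser B turns E into ω ≤
2; 2 ≤ ω is the flattening bound. -/
@[route_item "route-MatrixMultiplication-LongBlockAmortisation"]
def Assembly : Prop :=
  LongBlockPackings → FaceMaximiser → _root_.MatrixMultiplication

end Summit.MatrixMultiplication.MatrixMultiplication.Theses.LongBlockAmortisation
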